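import Summits.ValiantsHypothesis.ValiantsHypothesis.Theorems.LacunarySymmetroidMatrixDescartesCensusTwistedRolleMult
import Literature.Computability.AlgebraicComplexity.RealTauKnownCases
import Literature.Analysis.FluidPDE.ElgindiRadialCoefficients

/-!
# `MatrixDescartes` census — W4: the edge `3..9` of the tropical fan (THEOREM R3) is dead on EVERY support, in the kernel

HONEST FRAMING.  Object-search cell `pub-symmetroid`, item `DoorA26 = PosRootLawAt 2 6 19` (stmt-ValiantsHypothesis-19979,
OPEN, typed, never asserted).  The W4 line (engine-1 g17–g21: notes TROPFAN-W4-E1G17, CAPACITY09-E1G18, TWOROW-E1G19, W4-E1G20)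
studies the DEGENERATIONS of HYPOTHETICAL Descartes-sharp symmetric `2 × 2` six-term pencils.  On a support of chamber 1706
(pair-sum order of `(0,2,3,7,16,27)`) a degeneration whose direction lies in a face containing the elbows `3` and `9`
(32 faces of the cone `C₇`) has the hull edge `3..9`: the seven Gram entries `q₁₁, b₁₂, q₂₂, b₀₃, b₁₃, b₂₃, q₃₃` at the
exponents `2d₁ < d₁+d₂ < 2d₂ < d₃ < d₁+d₃ < d₂+d₃ < 2d₃`, with the `{1,2,3}` block of RANK ONE (initial system), i.e. the
edge form is `F = σ·(y₁X^{d₁} + y₂X^{d₂} + y₃X^{d₃})² + 2b₀₃ X^{d₃}`; hull-edge sharpness would need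
`6 = #terms − 1` positive roots COUNTED WITH MULTIPLICITY (seat note TROPFAN-W4-E1G17 §2 (R3), ADDENDUM rev 2).
This file proves `#Z₊^{mult}(F) ≤ 5 < 6` for ALL exponents `d₁ < d₂ < d₃` and ALL real letters (`y₃ ≠ 0`, `σ ≠ 0`;
no chamber inequality and no cell sign is used): ONE Euler twist at weight `d₃` kills the lone monomial and FACTORS,
`X·F′ − d₃·F = σ·p·(2X·p′ − d₃·p)` (`p` the trinomial), and each factor is a trinomial, so has at most `2` positive
roots with multiplicity (Descartes: fewer sign variations than monomials).  Hence the channel `3..9` is dead on every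
support of every chamber in which this edge pattern occurs (the seat's chamber-1706 count `≤ 4` used the cell's signs;
`5` already suffices).  Mirror statement (edge `11..17` on chamber 954) by `d ↦ −d` bookkeeping, not typed here.
Nothing in this file bounds `ζ_sym(2,6)`, decides `DoorA26`, or bears on the crux `MatrixDescartes`
(stmt-ValiantsHypothesis-18050) / `VP ≠ VNP`: a dead channel is a statement about hypothetical objects.

[folklore] Rolle with multiplicity (one Euler twist) + Descartes' bound by the number of monomials; no single source.
(The import of `Literature.Analysis.FluidPDE.ElgindiRadialCoefficients` only reuses its monomial identity
`X · (X^a)′ = a · X^a`, and `Literature.Computability.AlgebraicComplexity.RealTauKnownCases` its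
`signVariations_lt_card_support`, as the tree's dedup rule requires.)
-/

-- `Summit.ValiantsHypothesis.ValiantsHypothesis.…` repeats a component by the D-0017 layout
-- (single-conjunct summit), which the `dupNamespace` linter flags; the name is mandated.
set_option linter.dupNamespace false

namespace Summit.ValiantsHypothesis.ValiantsHypothesis.Theorems.LacunarySymmetroidMatrixDescartes.Census

open Polynomial Finset
open scoped BigOperators Polynomial

/-! ### Fewnomial bound with multiplicity -/

/-- **Descartes by the number of monomials, with multiplicity**: a non-zero real polynomial has fewer positive
roots, counted with multiplicity, than monomials (Mathlib's `roots_countP_pos_le_signVariations` and the tree's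
`signVariations_lt_card_support`). [folklore] -/
theorem countP_posRoots_lt_card_support {p : ℝ[X]} (hp : p ≠ 0) :
    p.roots.countP (fun x => 0 < x) < p.support.card :=
  (roots_countP_pos_le_signVariations p).trans_lt
    (Literature.Computability.AlgebraicComplexity.signVariations_lt_card_support hp)

/-! ### The twist identity: one Euler twist of `p² + c·X^n` at weight `n` factors through `p` -/

/-- The half-weight twist `X·p′ − (n/2)·p` has support inside the support of `p`. [folklore] -/
theorem support_halfTwist_subset (p : ℝ[X]) (n : ℕ) :
    (X * derivative p - C ((n : ℝ) / 2) * p).support ⊆ p.support := by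
  intro k hk
  rw [mem_support_iff] at hk ⊢
  rw [coeff_X_mul_derivative_sub_C_mul] at hk
  intro h
  exact hk (by rw [h, mul_zero])

/-- **Twist identity.**  `X·(p² + cX^n)′ − n·(p² + cX^n) = 2·p·(X·p′ − (n/2)·p)`: the Euler twist at weight `n`
kills the monomial `cX^n` and the twisted square FACTORS through `p`. [folklore] -/
theorem twist_sq_add_monomial (p : ℝ[X]) (c : ℝ) (n : ℕ) :
    X * derivative (p ^ 2 + C c * X ^ n) - C (n : ℝ) * (p ^ 2 + C c * X ^ n)
      = C 2 * (p * (X * derivative p - C ((n : ℝ) / 2) * p)) := by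
  have h := Literature.Analysis.FluidPDE.Elgindi.X_mul_derivative_X_pow n
  have h' : (X : ℝ[X]) * (C c * derivative (X ^ n)) = C c * (C (n : ℝ) * X ^ n) := by
    rw [← h]; ring
  have e2 : (C 2 : ℝ[X]) = 2 := map_ofNat C 2
  have e3 : (2 : ℝ[X]) * C ((n : ℝ) / 2) = C (n : ℝ) := by
    rw [← e2, ← C_mul]; congr 1; ring
  rw [sq, derivative_add, derivative_mul, derivative_C_mul, e2]
  linear_combination h' + (p * p) * e3

/-! ### THEOREM R3, support-free form -/

/-- **A square of a trinomial plus a monomial has at most five positive roots, counted with multiplicity.**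
For a real polynomial `p` with at most three monomials, any real `c` and any `n : ℕ` such that the half-weight twist
`X·p′ − (n/2)·p` is not the zero polynomial: `#Z₊^{mult}(p² + c·X^n) ≤ 5`.  (One twist loses at most one root and
leaves `2·p·(X p′ − (n/2) p)`, a product of two fewnomials with at most three monomials each.) [folklore] -/
theorem countP_posRoots_sq_add_monomial_le (p : ℝ[X]) (c : ℝ) (n : ℕ) (hp : p.support.card ≤ 3)
    (hq : X * derivative p - C ((n : ℝ) / 2) * p ≠ 0) :
    (p ^ 2 + C c * X ^ n).roots.countP (fun x => 0 < x) ≤ 5 := by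
  have hp0 : p ≠ 0 := by
    rintro rfl
    exact hq (by simp)
  have step := countP_posRoots_le_countP_posRoots_twist_succ (p ^ 2 + C c * X ^ n) n
  rw [twist_sq_add_monomial, countP_posRoots_C_mul _ (by norm_num : (2 : ℝ) ≠ 0),
    roots_mul (mul_ne_zero hp0 hq), Multiset.countP_add] at step
  have h1 : p.roots.countP (fun x => 0 < x) ≤ 2 := by
    have := countP_posRoots_lt_card_support hp0
    omega
  have h2 : (X * derivative p - C ((n : ℝ) / 2) * p).roots.countP (fun x => 0 < x) ≤ 2 := by
    have := countP_posRoots_lt_card_support hq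
    have := (Finset.card_le_card (support_halfTwist_subset p n)).trans hp
    omega
  omega

/-! ### THEOREM R3: the hull edge `3..9` (rank-one `{1,2,3}` block plus the `b₀₃` monomial) -/

/-- **THEOREM R3 (edge `3..9` dead, every support).**  For all exponents `d₁ < d₂ < d₃` and all real letters
`σ ≠ 0`, `y₁, y₂`, `y₃ ≠ 0`, `b`, the 7-term hull-edge form of the W4 edge `3..9`,
`F = σ·(y₁X^{d₁} + y₂X^{d₂} + y₃X^{d₃})² + 2b·X^{d₃}` (rank-one `{1,2,3}` Gram block plus the entry `b₀₃`), has at most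
`5 < 6 = #terms − 1` positive roots COUNTED WITH MULTIPLICITY — so no hypothetical twenty degenerates in a direction
whose hull has this edge (faces `∋ {3, 9}` of `C₇` on chamber 1706; mirror `{11, 17}` on 954). [folklore] -/
theorem countP_posRoots_zp_3_9_le (d₁ d₂ d₃ : ℕ) (h₁ : d₁ < d₂) (h₂ : d₂ < d₃) (σ y₁ y₂ y₃ b : ℝ) (hσ : σ ≠ 0)
    (hy₃ : y₃ ≠ 0) :
    ((C σ * (C y₁ * X ^ d₁ + C y₂ * X ^ d₂ + C y₃ * X ^ d₃) ^ 2 + C (2 * b) * X ^ d₃ : ℝ[X]).roots.countP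
      (fun x => 0 < x)) ≤ 5 := by
  set p : ℝ[X] := C y₁ * X ^ d₁ + C y₂ * X ^ d₂ + C y₃ * X ^ d₃ with hpdef
  -- normalise `σ` away: `σ p² + 2b X^{d₃} = σ · (p² + (2b/σ) X^{d₃})`
  have hnorm : (C σ * p ^ 2 + C (2 * b) * X ^ d₃ : ℝ[X]) = C σ * (p ^ 2 + C (2 * b / σ) * X ^ d₃) := by
    rw [mul_add, ← mul_assoc, ← C_mul, mul_div_cancel₀ _ hσ]
  rw [hnorm, countP_posRoots_C_mul _ hσ]
  refine countP_posRoots_sq_add_monomial_le p (2 * b / σ) d₃ ?_ ?_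
  · exact (Finset.card_le_card (support_trinomial_subset d₁ d₂ d₃ y₁ y₂ y₃)).trans Finset.card_le_three
  · -- the `X^{d₃}` coefficient of the half-weight twist is `(d₃ − d₃/2)·y₃ = (d₃/2)·y₃ ≠ 0` (`d₃ ≥ 2`)
    intro h0
    have hc := congr_arg (fun f : ℝ[X] => f.coeff d₃) h0
    simp only [coeff_X_mul_derivative_sub_C_mul, coeff_zero] at hc
    have hpc : p.coeff d₃ = y₃ := by
      rw [hpdef]
      simp only [coeff_add, coeff_C_mul, coeff_X_pow, if_true]
      rw [if_neg (by omega), if_neg (by omega)]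
      ring
    rw [hpc] at hc
    have hd : (0 : ℝ) < (d₃ : ℝ) - (d₃ : ℝ) / 2 := by
      have : (2 : ℝ) ≤ d₃ := by exact_mod_cast (show 2 ≤ d₃ by omega)
      linarith
    exact hy₃ ((mul_eq_zero.mp hc).resolve_left hd.ne')

end Summit.ValiantsHypothesis.ValiantsHypothesis.Theorems.LacunarySymmetroidMatrixDescartes.Census
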